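import Summits.Ventures.YMGap.RobustBall.Defs
import HarnessLib

/-!
# RobustBall/CentreTwist — linkwise centre twists of `SU(N)` lattice gauge fields: the central elements
# `ψ(a)·1` (`a ∈ ℤ/N`), LINKWISE centre-blind perturbations, and the holonomies / Wilson action / Wilson
# loop of a centrally twisted configuration

HONEST FRAMING: venture file of the cell `pub-ymgap` (QuantumFields programme), track Y2 ROBUST-BALL, seat
ds-4 g7 — the ALGEBRAIC half of the centre-projection bound (Fröhlich 1979 / Mack–Petkova 1979): pure
group / matrix bookkeeping on the finite torus, no measure, no expectation, no area law in this file;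
nothing about the continuum limit or a Clay-sense mass gap anywhere on this track.

Contents.
* `centreOf a` (`a : ZMod N`): the central element `ψ(a)·1 ∈ SU(N)`, `ψ = ZMod.stdAddChar` the standard
  additive character `a ↦ e^{2πi a/N}`; `centreOf (a + b) = centreOf a * centreOf b`, `centreOf` is
  central (`centreOf_mem_center`), `tr(centreOf a · g) = ψ(a) tr g`.
* `IsCentreBlind W` — rb-theory's reserved predicate (ROBUST-BALL-STATEMENT §6(c), v1.21): the total
  perturbation is invariant under multiplying EACH LINK INDEPENDENTLY by a central element
  (`W.total (ζ • U) = W.total U` for every `ζ : links → centre`).  LINKWISE: strictly stronger than the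
  slab-wise `IsSlabLocal.center_inv` / `centerSlabRotate` invariance of `AreaLawOnBallC`, which
  `not_areaLawOnBallC` (lit-1) shows insufficient for a window-free area law.  Members: every
  plaquette / loop action through class functions `f` with `f (z g) = f g` for central `z` (adjoint and
  mixed fundamental–adjoint actions of ANY size, `|tr U_C|²` terms, …) — `isCentreBlind_of_plaquetteAction`.
* holonomies of twisted configurations: for a central-valued `ζ`, `plaquetteHolonomy (ζ * U) =
  plaquetteHolonomy ζ * plaquetteHolonomy U` and the same for `rectangleHolonomy`
  (`fourTerm_mul_of_center`); for `ζ = centreOf ∘ k`, `k : links → ℤ/N`, the twist holonomies are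
  `centreOf (plaqSum k p)` / `centreOf (loopSum k …)` (discrete curl / boundary sum of `k`), so
  `S(ζ_k U) = ∑_p (N − Re(ψ(plaqSum k p) tr U_p))` (`wilsonAction_twist`) and
  `tr (ζ_k U)_{∂R×T} = ψ(loopSum k) tr U_{∂R×T}` (`loopTrace_twist`).

References (mechanism, AS PRINTED): J. Fröhlich, Phys. Lett. B 83 (1979) 195–198; G. Mack,
V. B. Petkova, Ann. Phys. 123 (1979) 442–467.
-/

noncomputable section

open Finset
open Literature.MathematicalPhysics.QuantumLattice (fundamentalRep fundamentalRep_apply)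
open Literature.MathematicalPhysics.QuantumFieldTheory

namespace Summit.Ventures.YMGap.RobustBall

variable {d L N : ℕ}

/-! ### Four-term products with central factors -/

section Central

variable {G : Type*} [Group G]

/-- `(z₁ X)(z₂ Y) = (z₁ z₂)(X Y)` when `z₂` is central. [folklore] -/
theorem central_mul_mul {z₂ : G} (hz₂ : z₂ ∈ Subgroup.center G) (z₁ X Y : G) :
    z₁ * X * (z₂ * Y) = z₁ * z₂ * (X * Y) := by
  calc z₁ * X * (z₂ * Y) = z₁ * (X * z₂) * Y := by simp only [mul_assoc]
    _ = z₁ * (z₂ * X) * Y := by rw [Subgroup.mem_center_iff.1 hz₂ X]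
    _ = z₁ * z₂ * (X * Y) := by simp only [mul_assoc]

/-- The four-term holonomy shape with central prefactors:
`(aA)(bB)(cC)⁻¹(dD)⁻¹ = (a b c⁻¹ d⁻¹)(A B C⁻¹ D⁻¹)`. [folklore] -/
theorem fourTerm_mul_of_center (a : G) {b c dd : G} (hb : b ∈ Subgroup.center G)
    (hc : c ∈ Subgroup.center G) (hd : dd ∈ Subgroup.center G) (A B C D : G) :
    a * A * (b * B) * (c * C)⁻¹ * (dd * D)⁻¹ = a * b * c⁻¹ * dd⁻¹ * (A * B * C⁻¹ * D⁻¹) := by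
  have hc' : c⁻¹ ∈ Subgroup.center G := inv_mem hc
  have hd' : dd⁻¹ ∈ Subgroup.center G := inv_mem hd
  have h1 : (c * C)⁻¹ = c⁻¹ * C⁻¹ := by rw [mul_inv_rev, Subgroup.mem_center_iff.1 hc' C⁻¹]
  have h2 : (dd * D)⁻¹ = dd⁻¹ * D⁻¹ := by rw [mul_inv_rev, Subgroup.mem_center_iff.1 hd' D⁻¹]
  rw [h1, h2, central_mul_mul hb, central_mul_mul hc', central_mul_mul hd']

/-- **Plaquette holonomy of a centrally twisted configuration**: `(ζU)_p = ζ_p · U_p`. [folklore] -/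
theorem plaquetteHolonomy_mul_of_center (ζ U : GaugeConfig d L G) (hζ : ∀ e, ζ e ∈ Subgroup.center G)
    (x : Site d L) (i j : Fin d) :
    plaquetteHolonomy (ζ * U) x i j = plaquetteHolonomy ζ x i j * plaquetteHolonomy U x i j := by
  simp only [plaquetteHolonomy, Pi.mul_apply]
  exact fourTerm_mul_of_center _ (hζ _) (hζ _) (hζ _) _ _ _ _

/-- Line holonomies of a central-valued configuration are central, and line holonomies of a centrally
twisted configuration factor: `P(ζU) = P(ζ) P(U)`. [folklore] -/
theorem lineHolonomy_mul_of_center (ζ U : GaugeConfig d L G) (hζ : ∀ e, ζ e ∈ Subgroup.center G)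
    (k : Fin d) : ∀ (n : ℕ) (y : Site d L),
    lineHolonomy ζ k n y ∈ Subgroup.center G ∧
      lineHolonomy (ζ * U) k n y = lineHolonomy ζ k n y * lineHolonomy U k n y
  | 0, y => ⟨by simp [lineHolonomy], by simp [lineHolonomy]⟩
  | n + 1, y => by
      obtain ⟨hc, heq⟩ := lineHolonomy_mul_of_center ζ U hζ k n (y.shift k)
      refine ⟨?_, ?_⟩
      · show ζ (y, k) * lineHolonomy ζ k n (y.shift k) ∈ Subgroup.center G
        exact mul_mem (hζ _) hc
      · show (ζ * U) (y, k) * lineHolonomy (ζ * U) k n (y.shift k) =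
          ζ (y, k) * lineHolonomy ζ k n (y.shift k) * (U (y, k) * lineHolonomy U k n (y.shift k))
        rw [heq, Pi.mul_apply, ← central_mul_mul hc, mul_assoc]

/-- **Rectangle holonomy of a centrally twisted configuration**: `(ζU)_{∂R×T} = ζ_{∂R×T} · U_{∂R×T}`,
with `ζ_{∂R×T}` central. [folklore] -/
theorem rectangleHolonomy_mul_of_center (ζ U : GaugeConfig d L G) (hζ : ∀ e, ζ e ∈ Subgroup.center G)
    (x : Site d L) (i j : Fin d) (R T : ℕ) :
    rectangleHolonomy (ζ * U) x i j R T = rectangleHolonomy ζ x i j R T * rectangleHolonomy U x i j R T := by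
  simp only [rectangleHolonomy, (lineHolonomy_mul_of_center ζ U hζ _ _ _).2]
  exact fourTerm_mul_of_center _
    (lineHolonomy_mul_of_center ζ U hζ _ _ _).1 (lineHolonomy_mul_of_center ζ U hζ _ _ _).1
    (lineHolonomy_mul_of_center ζ U hζ _ _ _).1 _ _ _ _

end Central

/-! ### The central elements `ψ(a)·1` of `SU(N)` -/

section CentreOf

variable [NeZero N]

/-- The standard additive character of `ℤ/N`: `ψ(a) = e^{2πi a/N}`. [folklore] -/
abbrev ψ (N : ℕ) [NeZero N] (a : ZMod N) : ℂ := ZMod.stdAddChar a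

/-- `‖ψ a‖ = 1`. [folklore] -/
theorem norm_ψ (a : ZMod N) : ‖ψ N a‖ = 1 := by
  rw [ψ, ZMod.stdAddChar_apply, Circle.norm_coe]

/-- `ψ (a + b) = ψ a ψ b`. [folklore] -/
theorem ψ_add (a b : ZMod N) : ψ N (a + b) = ψ N a * ψ N b := AddChar.map_add_eq_mul _ _ _

/-- `ψ 0 = 1`. [folklore] -/
theorem ψ_zero : ψ N 0 = 1 := AddChar.map_zero_eq_one _

/-- `ψ a · conj (ψ a) = 1`. [folklore] -/
theorem ψ_mul_conj (a : ZMod N) : ψ N a * (starRingEnd ℂ) (ψ N a) = 1 := by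
  rw [Complex.mul_conj, Complex.normSq_eq_norm_sq, norm_ψ]; simp

/-- `ψ(a)^N = 1`. [folklore] -/
theorem ψ_pow_card (a : ZMod N) : ψ N a ^ N = 1 := by
  rw [ψ, ← AddChar.map_nsmul_eq_pow, nsmul_eq_mul, ZMod.natCast_self, zero_mul, AddChar.map_zero_eq_one]

/-- `ψ 1 ≠ 1` for `N ≥ 2` (the character is faithful). [folklore] -/
theorem ψ_one_ne_one (hN : 2 ≤ N) : ψ N 1 ≠ 1 := by
  intro h
  have h1 : ZMod.toCircle (1 : ZMod N) = ZMod.toCircle (0 : ZMod N) := by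
    apply Subtype.ext
    rw [← ZMod.stdAddChar_apply, ← ZMod.stdAddChar_apply, AddChar.map_zero_eq_one]
    exact h
  have h01 : (1 : ZMod N) = 0 := ZMod.injective_toCircle h1
  have : Fact (1 < N) := ⟨hN⟩
  exact one_ne_zero h01

/-- **The central element `ψ(a)·1` of `SU(N)`.** [folklore] -/
def centreOf (a : ZMod N) : SUN N :=
  ⟨ψ N a • (1 : Matrix (Fin N) (Fin N) ℂ), by
    rw [Matrix.mem_specialUnitaryGroup_iff]
    refine ⟨?_, ?_⟩
    · rw [Matrix.mem_unitaryGroup_iff, star_smul, star_one, smul_mul_smul_comm, one_mul,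
        Complex.star_def, ψ_mul_conj, one_smul]
    · rw [Matrix.det_smul, Matrix.det_one, mul_one, Fintype.card_fin, ψ_pow_card]⟩

/-- The central element as a matrix. [folklore] -/
@[simp] theorem coe_centreOf (a : ZMod N) :
    ((centreOf a : SUN N) : Matrix (Fin N) (Fin N) ℂ) = ψ N a • (1 : Matrix (Fin N) (Fin N) ℂ) := rfl

/-- `centreOf` is additive-to-multiplicative. [folklore] -/
theorem centreOf_add (a b : ZMod N) : centreOf (a + b) = centreOf a * centreOf b := by
  apply Subtype.ext
  rw [coe_centreOf, Submonoid.coe_mul, coe_centreOf, coe_centreOf, smul_mul_smul_comm, one_mul, ψ_add]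

/-- `centreOf 0 = 1`. [folklore] -/
@[simp] theorem centreOf_zero : centreOf (0 : ZMod N) = 1 := by
  apply Subtype.ext
  rw [coe_centreOf, ψ_zero, one_smul]; rfl

/-- `centreOf (−a) = (centreOf a)⁻¹`. [folklore] -/
theorem centreOf_neg (a : ZMod N) : centreOf (-a) = (centreOf a)⁻¹ := by
  rw [eq_inv_iff_mul_eq_one, ← centreOf_add, neg_add_cancel, centreOf_zero]

/-- `centreOf (a − b) = centreOf a * (centreOf b)⁻¹`. [folklore] -/
theorem centreOf_sub (a b : ZMod N) : centreOf (a - b) = centreOf a * (centreOf b)⁻¹ := by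
  rw [sub_eq_add_neg, centreOf_add, centreOf_neg]

/-- **`centreOf a` is central in `SU(N)`.** [folklore] -/
theorem centreOf_mem_center (a : ZMod N) : centreOf a ∈ Subgroup.center (SUN N) := by
  rw [Subgroup.mem_center_iff]
  intro g
  apply Subtype.ext
  rw [Submonoid.coe_mul, Submonoid.coe_mul, coe_centreOf, Matrix.mul_smul, Matrix.smul_mul, mul_one, one_mul]

/-- **Schur on the fundamental representation, explicit form**: `tr(centreOf a · g) = ψ(a) · tr g`. [folklore] -/
theorem trace_centreOf_mul (a : ZMod N) (g : SUN N) :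
    ((centreOf a * g : SUN N) : Matrix (Fin N) (Fin N) ℂ).trace = ψ N a * (g : Matrix (Fin N) (Fin N) ℂ).trace := by
  rw [Submonoid.coe_mul, coe_centreOf, Matrix.smul_mul, one_mul, Matrix.trace_smul, smul_eq_mul]

end CentreOf

/-! ### LINKWISE centre-blind perturbations (rb-theory's reserved predicate, §6(c)) -/

/-- **`IsCentreBlind W`** (ROBUST-BALL-STATEMENT §6(c), rb-theory v1.21, name reserved 2026-08-23): the total
perturbation is invariant under multiplying EACH LINK INDEPENDENTLY by an arbitrary central element of
`SU(N)` — `W.total (ζ • U) = W.total U` for every `ζ : links → centre SU(N)`.  LINKWISE (each link on its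
own): strictly stronger than the slab-wise invariance `IsSlabLocal.center_inv` (all vertical links of one slab
rotated by the SAME central element) under which the window-free tier-2 area law is FALSE
(`not_areaLawOnBallC`).  This is the `N`-ality-zero class: adjoint / mixed fundamental–adjoint plaquette and
loop actions of any size and range, `|tr U_C|²` terms, products `tr U_p · conj tr U_q` only when every link
carries zero net `N`-ality. [folklore] -/
def IsCentreBlind [NeZero L] (W : Perturbation d L N) : Prop :=
  ∀ ζ : Edge d L → SUN N, (∀ e, ζ e ∈ Subgroup.center (SUN N)) →
    ∀ U : GaugeConfig d L (SUN N), W.total (fun e => ζ e * U e) = W.total U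

/-- The zero perturbation is centre-blind. [folklore] -/
theorem isCentreBlind_zero [NeZero L] : IsCentreBlind (0 : Perturbation d L N) := fun _ _ _ => by simp

/-- Centre-blind perturbations form an additive subgroup: sums. [folklore] -/
theorem IsCentreBlind.add [NeZero L] {W W' : Perturbation d L N} (h : IsCentreBlind W) (h' : IsCentreBlind W') :
    IsCentreBlind (W + W') := fun ζ hζ U => by
  rw [QuasiLocalGaugePerturbation.total_add, Pi.add_apply, Pi.add_apply, h ζ hζ U, h' ζ hζ U]

/-- Centre-blind perturbations form an additive subgroup: negation. [folklore] -/
theorem IsCentreBlind.neg [NeZero L] {W : Perturbation d L N} (h : IsCentreBlind W) : IsCentreBlind (-W) :=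
  fun ζ hζ U => by rw [QuasiLocalGaugePerturbation.total_neg, Pi.neg_apply, Pi.neg_apply, h ζ hζ U]

/-- **Plaquette actions through centre-invariant class functions are centre-blind**: if
`W.total U = ∑_q f(U_q)` with `f (z g) = f g` for every central `z` (e.g. the adjoint plaquette action
`f g = β_A |tr g|²` of ANY size `β_A`), then `W` is linkwise centre-blind. [folklore] -/
theorem isCentreBlind_of_plaquetteAction [NeZero L] {W : Perturbation d L N} {f : SUN N → ℝ}
    (hW : IsPlaquetteAction f W) (hf : ∀ z ∈ Subgroup.center (SUN N), ∀ g, f (z * g) = f g) :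
    IsCentreBlind W := fun ζ hζ U => by
  rw [hW, hW]
  refine Finset.sum_congr rfl fun q _ => ?_
  have h := plaquetteHolonomy_mul_of_center ζ U hζ q.1 q.2.1.1 q.2.1.2
  rw [show (fun e => ζ e * U e) = ζ * U from rfl, h]
  refine hf _ ?_ _
  simp only [plaquetteHolonomy]
  exact mul_mem (mul_mem (mul_mem (hζ _) (hζ _)) (inv_mem (hζ _))) (inv_mem (hζ _))

/-- Example: `|tr g|²` is invariant under central multiplication by `centreOf a` (the adjoint character
`|tr g|² − 1` of `SU(N)` up to a constant), so every plaquette action built from it is centre-blind AT ANY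
COUPLING. [folklore] -/
theorem normSq_trace_centreOf_mul [NeZero N] (a : ZMod N) (g : SUN N) :
    Complex.normSq ((centreOf a * g : SUN N) : Matrix (Fin N) (Fin N) ℂ).trace =
      Complex.normSq (g : Matrix (Fin N) (Fin N) ℂ).trace := by
  rw [trace_centreOf_mul, Complex.normSq_mul, Complex.normSq_eq_norm_sq (ψ N a), norm_ψ, one_pow, one_mul]

/-! ### Twists by `k : links → ℤ/N`: discrete curl and boundary sums -/

section Twist

variable [NeZero N]

/-- The central twist field of `k : links → ℤ/N`. [folklore] -/
def twistOf (k : Edge d L → ZMod N) : GaugeConfig d L (SUN N) := fun e => centreOf (k e)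

/-- Every value of `twistOf k` is central. [folklore] -/
theorem twistOf_mem_center (k : Edge d L → ZMod N) (e : Edge d L) : twistOf k e ∈ Subgroup.center (SUN N) :=
  centreOf_mem_center _

/-- The discrete curl of `k` around the plaquette at `x` in the `(i, j)` plane:
`k(x,i) + k(x+eᵢ,j) − k(x+eⱼ,i) − k(x,j)`. [folklore] -/
def plaqSum (k : Edge d L → ZMod N) (x : Site d L) (i j : Fin d) : ZMod N :=
  k (x, i) + k (x.shift i, j) - k (x.shift j, i) - k (x, j)

/-- The plaquette holonomy of the twist field is `centreOf` of the discrete curl. [folklore] -/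
theorem plaquetteHolonomy_twistOf (k : Edge d L → ZMod N) (x : Site d L) (i j : Fin d) :
    plaquetteHolonomy (twistOf k) x i j = centreOf (plaqSum k x i j) := by
  simp only [plaquetteHolonomy, twistOf, plaqSum, centreOf_sub, centreOf_add]

/-- The sum of `k` along the straight path of `n` steps in direction `i` from `y`. [folklore] -/
def lineSum (k : Edge d L → ZMod N) (i : Fin d) : ℕ → Site d L → ZMod N
  | 0, _ => 0
  | n + 1, y => k (y, i) + lineSum k i n (y.shift i)

/-- The line holonomy of the twist field is `centreOf` of the line sum. [folklore] -/
theorem lineHolonomy_twistOf (k : Edge d L → ZMod N) (i : Fin d) :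
    ∀ (n : ℕ) (y : Site d L), lineHolonomy (twistOf k) i n y = centreOf (lineSum k i n y)
  | 0, y => by simp [lineHolonomy, lineSum]
  | n + 1, y => by
      show twistOf k (y, i) * lineHolonomy (twistOf k) i n (y.shift i) = centreOf (k (y, i) + lineSum k i n (y.shift i))
      rw [lineHolonomy_twistOf k i n, twistOf, centreOf_add]

/-- The boundary sum of `k` around the `R × T` rectangle at `x` in the `(i, j)` plane (bottom + right − top −
left). [folklore] -/
def loopSum (k : Edge d L → ZMod N) (x : Site d L) (i j : Fin d) (R T : ℕ) : ZMod N :=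
  lineSum k i R x + lineSum k j T (x + Pi.single i (R : ZMod L)) -
    lineSum k i R (x + Pi.single j (T : ZMod L)) - lineSum k j T x

/-- The rectangle holonomy of the twist field is `centreOf` of the boundary sum. [folklore] -/
theorem rectangleHolonomy_twistOf (k : Edge d L → ZMod N) (x : Site d L) (i j : Fin d) (R T : ℕ) :
    rectangleHolonomy (twistOf k) x i j R T = centreOf (loopSum k x i j R T) := by
  simp only [rectangleHolonomy, lineHolonomy_twistOf, loopSum, centreOf_sub, centreOf_add]

/-- **Wilson action of a twisted configuration**: `S(ζ_k U) = ∑_p (N − Re(ψ(curl k)_p · tr U_p))`. [folklore] -/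
theorem wilsonAction_twist [NeZero L] (k : Edge d L → ZMod N) (U : GaugeConfig d L (SUN N)) :
    wilsonAction (fundamentalRep (Fin N)) (twistOf k * U) =
      ∑ p : Plaquette d L, ((N : ℝ) - (ψ N (plaqSum k p.1 p.2.1.1 p.2.1.2) *
        ((plaquetteHolonomy U p.1 p.2.1.1 p.2.1.2 : SUN N) : Matrix (Fin N) (Fin N) ℂ).trace).re) := by
  unfold wilsonAction
  refine Finset.sum_congr rfl fun p _ => ?_
  rw [fundamentalRep_apply, plaquetteHolonomy_mul_of_center _ _ (twistOf_mem_center k), plaquetteHolonomy_twistOf,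
    trace_centreOf_mul]

/-- The complex Wilson loop `tr U_{∂R×T} / N`. [folklore] -/
def loopTrace (x : Site d L) (i j : Fin d) (R T : ℕ) (U : GaugeConfig d L (SUN N)) : ℂ :=
  ((N : ℂ))⁻¹ * ((rectangleHolonomy U x i j R T : SUN N) : Matrix (Fin N) (Fin N) ℂ).trace

omit [NeZero N] in
/-- The real Wilson loop is the real part of the complex one. [folklore] -/
theorem wilsonLoop_eq_re_loopTrace (x : Site d L) (i j : Fin d) (R T : ℕ) (U : GaugeConfig d L (SUN N)) :
    wilsonLoop (fundamentalRep (Fin N)) x i j R T U = (loopTrace x i j R T U).re := by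
  rw [wilsonLoop, loopTrace, fundamentalRep_apply, ← Complex.ofReal_natCast, ← Complex.ofReal_inv,
    Complex.re_ofReal_mul]

omit [NeZero N] in
/-- `|tr g| ≤ N` for `g ∈ SU(N)`. [folklore] -/
theorem norm_trace_le (g : SUN N) : ‖(g : Matrix (Fin N) (Fin N) ℂ).trace‖ ≤ N := by
  calc ‖(g : Matrix (Fin N) (Fin N) ℂ).trace‖ = ‖∑ a, (g : Matrix (Fin N) (Fin N) ℂ) a a‖ := rfl
    _ ≤ ∑ a, ‖(g : Matrix (Fin N) (Fin N) ℂ) a a‖ := norm_sum_le _ _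
    _ ≤ ∑ _a : Fin N, (1 : ℝ) := Finset.sum_le_sum fun a _ =>
        entry_norm_bound_of_unitary (Matrix.mem_specialUnitaryGroup_iff.1 g.2).1 a a
    _ = N := by simp

omit [NeZero N] in
/-- `‖loopTrace‖ ≤ 1`. [folklore] -/
theorem norm_loopTrace_le_one (x : Site d L) (i j : Fin d) (R T : ℕ) (U : GaugeConfig d L (SUN N)) :
    ‖loopTrace x i j R T U‖ ≤ 1 := by
  rcases Nat.eq_zero_or_pos N with hN | hN
  · subst hN; simp [loopTrace]
  · have hNr : (0 : ℝ) < N := by exact_mod_cast hN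
    rw [loopTrace, norm_mul, norm_inv, Complex.norm_natCast, inv_mul_le_iff₀ hNr, mul_one]
    exact norm_trace_le _

/-- **Wilson loop of a twisted configuration**: `tr(ζ_k U)_{∂R×T}/N = ψ(loopSum k) · tr U_{∂R×T}/N`. [folklore] -/
theorem loopTrace_twist (k : Edge d L → ZMod N) (x : Site d L) (i j : Fin d) (R T : ℕ)
    (U : GaugeConfig d L (SUN N)) :
    loopTrace x i j R T (twistOf k * U) = ψ N (loopSum k x i j R T) * loopTrace x i j R T U := by
  rw [loopTrace, loopTrace, rectangleHolonomy_mul_of_center _ _ (twistOf_mem_center k), rectangleHolonomy_twistOf,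
    trace_centreOf_mul]
  ring

end Twist

end Summit.Ventures.YMGap.RobustBall

end
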